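import Summits.ABC.IUTFork.Joshi.RosettaFragment1
import Summits.ABC.IUTFork.Joshi.ArithTeichmullerAction
import HarnessLib

/-!
# [J-III] Thm. 8.3.3.1 (plurality clause) ↔ [J-I]'s use of [KedlayaTemkin2018]: the claim-Prop reduced to E-t1's named fact

Proof-only bookkeeping (block E, seat abc-iut-E-t16, slot T-16). `Rosetta.ManyInequivalentPictures` (Joshi/RosettaFragment1.lean,
p429272) types the plurality clause of [J-III] Thm. 8.3.3.1 (arXiv:2401.13508v4 p.77 l.17–18: «there exist many
inequivalent étale and Frobenius pictures in [Mochizuki, 2021a,b,c]») for a family of untilts as «two members are not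
topologically isomorphic». E-t1's `UntiltPoints` datum (Joshi/ArithTeichmullerAction.lean: the closed degree-one points
`y` of the Fargues–Fontaine curve with their residue-field untilts `D.untilt y` and the `Aut_{𝒪_E}(𝒢(𝒪_F))`-action,
[J-I] Thm. (th:main3)) carries exactly the inputs print gives for it: the NAMED refereed fact
`UntiltPoints.ExistsNonIsomorphic` ([cite: KedlayaTemkin2018, Thm 1.3] as used in [J-I] §3, chunk p0008 «there exist
untilts of `ℂ_p^♭` which are not topologically isomorphic») and Joshi's claim `UntiltPoints.ActionChangesTopology`
([J-I] §1 chunk p0005). PROVED here: for the family `y ↦ D.untilt y`, Thm. 8.3.3.1's plurality IS E-t1's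
`ExistsNonIsomorphic` (`Iff.rfl` — the two seats typed the same sentence), hence follows from `ActionChangesTopology`
(E-t1's `existsNonIsomorphic_of_actionChangesTopology`). So the T-16 claim-Prop is DISCHARGED MODULO the named fact
[KedlayaTemkin2018] — nothing is asserted; bib `Joshi2024ATS3` / `Joshi2021ATS1` (unrefereed, `disputed`); typed ≠ proved
≠ endorsed; no side taken on [IUTchIII] Cor. 3.12 or on any author. Standard axioms only; sorry-free. bears_on: LADDER-ABC:A2.E.
-/

namespace Summit.ABC.IUTFork.Joshi.Rosetta

variable {p : ℕ} [Fact p.Prime] {𝒪E : Type} [CommRing 𝒪E] (D : UntiltPoints p 𝒪E)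

/-- PROVED (`Iff.rfl`): for the residue-field family of E-t1's `UntiltPoints` datum, the plurality clause of [J-III]
Thm. 8.3.3.1 (`ManyInequivalentPictures`) IS [J-I]'s use of [KedlayaTemkin2018] (`UntiltPoints.ExistsNonIsomorphic`). -/
theorem manyInequivalentPictures_iff_existsNonIsomorphic :
    ManyInequivalentPictures D.untilt ↔ D.ExistsNonIsomorphic :=
  Iff.rfl

/-- PROVED: the named fact [KedlayaTemkin2018] (as typed by E-t1) yields Thm. 8.3.3.1's plurality for the family of
residue-field untilts — the claim-Prop DISCHARGED MODULO that named fact. -/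
theorem manyInequivalentPictures_of_existsNonIsomorphic (h : D.ExistsNonIsomorphic) :
    ManyInequivalentPictures D.untilt :=
  h

/-- PROVED: Joshi's «the action changes the topology of the overfield» ([J-I] §1, E-t1's claim-Prop
`UntiltPoints.ActionChangesTopology`) also yields Thm. 8.3.3.1's plurality (via E-t1's
`existsNonIsomorphic_of_actionChangesTopology`). -/
theorem manyInequivalentPictures_of_actionChangesTopology (h : D.ActionChangesTopology) :
    ManyInequivalentPictures D.untilt :=
  D.existsNonIsomorphic_of_actionChangesTopology h

/-- PROVED (with `UntiltNonIsometry.lean`'s content restated on this family): under [KedlayaTemkin2018] as typed, some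
two residue-field untilts admit NO isometric field isomorphism — for every `e : K_y ≃+* K_{y'}` some norm moves.
(Self-contained elementary proof: an isometric field isomorphism is a `TopEquiv`.) -/
theorem exists_pair_no_isometry_of_existsNonIsomorphic (h : D.ExistsNonIsomorphic) :
    ∃ y y' : D.Pt, ∀ e : (D.untilt y).K ≃+* (D.untilt y').K, ∃ x, ‖e x‖ ≠ ‖x‖ := by
  obtain ⟨y, y', hyy'⟩ := h
  refine ⟨y, y', fun e => ?_⟩
  by_contra hall
  push Not at hall
  refine hyy' ⟨⟨e, ?_, ?_⟩⟩
  · exact AddMonoidHomClass.continuous_of_bound e 1 fun x => by rw [one_mul, hall x]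
  · refine AddMonoidHomClass.continuous_of_bound e.symm 1 fun x => ?_
    rw [one_mul]
    have := hall (e.symm x)
    rw [RingEquiv.apply_symm_apply] at this
    exact le_of_eq this.symm

end Summit.ABC.IUTFork.Joshi.Rosetta
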